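import Mathlib
import HarnessLib
import Summits.Ventures.LatticeQCDFlow.Exactness.NCMCGeneralSpaceGammaMethodMSE

/-!
# The Γ-method window on a path and the truncation tail under a Doeblin POWER: `Γ̂_N(0) + 2 Σ_{t≤W} Γ̂_N(t) = Γ̂_N(0) · 2 τ̂_{N,W}` on every path, `Σ_{t>W} |C_f̄(t)| ≤ 2 (2C)² (m/ε) (1 − ε)^{⌊(W+1)/m⌋}`, and the pointwise splitting of the windowed error

HONEST FRAMING: exact (Metropolis-corrected) sampling algorithms for lattice gauge theory;
figures of merit are autocorrelation/cost numbers at stated couplings and volumes; no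
continuum-physics claim.

Venture `LatticeQCDFlow` (cell pub-lqcd), topic `Exactness`; FANOUT row 13 (`eng-snf`, GEN-20).
NEW WORK of the cell, not a published result; no definition is introduced; nothing is cited as a
fact.  Bookkeeping for `NCMCGeneralSpaceGammaMethodConsistency.lean` (the consistency of scorer A's
Γ-method estimator of the asymptotic variance along a chain with a Doeblin power).  Scorer A's objects
are row 11's verbatim typing (`Scoring/SampleACFSumZero.lean`: `acovSum`, `gammaHat`, `rhoHat`;
`Scoring/CalibrationTruths.tauIntWindow`).  §1: the Doeblin envelope of the stationary autocovariances
of `f̄ = f − πf` (`|C_f̄(t)| ≤ 2 (2C)² (1 − e)^{⌊t/m⌋}`, from GEN-19's sup-norm decay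
`NCMCGeneralSpaceDoeblinPowerPoisson.decay_of_nHit`) and its tail beyond a window.  §2: on EVERY real
series the windowed autocovariance sum `Γ̂_N(0) + 2 Σ_{t<W} Γ̂_N(t+1)` equals `Γ̂_N(0) · (2 τ̂_{N,W})` with
`τ̂_{N,W} = tauIntWindow (rhoHat y N) W` the printed `tau_int_W` (row 11's
`gammaHat_mul_two_mul_tauIntWindow`, extended to constant series where both sides vanish), and the
squared windowed error splits as `≤ 3 a_0² + 12 W Σ_{t<W} a_{t+1}² + 12 T²` (Cauchy–Schwarz over the
window), integrated against any probability law for bounded measurable lag statistics.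

## Content

* `abs_autocov_centred_le_of_nHit`, `summable_autocov_centred_succ_of_nHit`,
  **`tsum_abs_autocov_shift_le_of_nHit`** (`Σ'_t |C_f̄(t + W + 1)| ≤ 2 (2C)² (m/e) (1 − e)^{⌊(W+1)/m⌋}`);
* `gammaHat_eq_zero_of_acovSum_zero`, **`gammaWindow_eq_gammaHat_mul_tauIntWindow`**;
* `sq_gammaWindow_sub_le`, `integral_sq_windowSum_sub_le`.

NOT CLAIMED: anything about the automatic window; any number of ours.
-/

namespace Summit.Ventures.LatticeQCDFlow.Exactness.GeneralNCMC

open MeasureTheory ProbabilityTheory Set Filter Finset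
open scoped ENNReal Topology

variable {S : Type*} [MeasurableSpace S]

/-! ## §1 The truncation tail of the Doeblin envelope -/

section Tail

variable {κ : Kernel S S} [IsMarkovKernel κ] {ν : Measure S} [IsProbabilityMeasure ν] {ε : ℝ≥0∞}
  {π : Measure S} [IsProbabilityMeasure π] {m : ℕ}

/-- `|C_f̄(t)| ≤ 2 (2C)² (1 − ε)^{⌊t/m⌋}` for the centred observable `f̄ = f − πf`, `|f| ≤ C`. -/
theorem abs_autocov_centred_le_of_nHit
    (hmin : ∀ x {B : Set S}, MeasurableSet B → ε * ν B ≤ nHit κ m x B) (hε1 : ε ≤ 1)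
    (hπ : Kernel.Invariant κ π) {f : S → ℝ} (hf : Measurable f) {C : ℝ} (hC : ∀ x, |f x| ≤ C)
    (t : ℕ) :
    |Scoring.autocov κ π (fun y => f y - ∫ z, f z ∂π) t| ≤ 2 * (2 * C) ^ 2 * (1 - ε.toReal) ^ (t / m) := by
  obtain ⟨hfb, hCfb, hfb0⟩ := Scoring.centred_observable_bounds π hf hC
  have h := abs_autocov_le_of_envelope (κ := κ) (π := π) hCfb
    (decay_of_nHit hmin hε1 hπ _ hfb (2 * C) hCfb hfb0) t
  calc |Scoring.autocov κ π (fun y => f y - ∫ z, f z ∂π) t|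
      ≤ 2 * C * (2 * (2 * C) * (1 - ε.toReal) ^ (t / m)) := h
    _ = 2 * (2 * C) ^ 2 * (1 - ε.toReal) ^ (t / m) := by ring

/-- The shifted autocovariances `t ↦ C_f̄(t + 1)` are summable under a Doeblin power. -/
theorem summable_autocov_centred_succ_of_nHit
    (hmin : ∀ x {B : Set S}, MeasurableSet B → ε * ν B ≤ nHit κ m x B) (hε0 : 0 < ε) (hε1 : ε ≤ 1)
    (hm : 0 < m) (hπ : Kernel.Invariant κ π) {f : S → ℝ} (hf : Measurable f) {C : ℝ}
    (hC : ∀ x, |f x| ≤ C) :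
    Summable fun t => Scoring.autocov κ π (fun y => f y - ∫ z, f z ∂π) (t + 1) := by
  have hεtop : ε ≠ ∞ := ne_top_of_le_ne_top ENNReal.one_ne_top hε1
  have hεpos : 0 < ε.toReal := ENNReal.toReal_pos hε0.ne' hεtop
  have hr0 : 0 ≤ 1 - ε.toReal :=
    sub_nonneg.2 (ENNReal.toReal_le_of_le_ofReal zero_le_one (by simpa using hε1))
  have hr1 : 1 - ε.toReal < 1 := sub_lt_self _ hεpos
  refine Summable.of_norm_bounded ((Scoring.summable_pow_div hm hr0 hr1).mul_left (2 * (2 * C) ^ 2))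
    fun t => ?_
  rw [Real.norm_eq_abs]
  refine (abs_autocov_centred_le_of_nHit hmin hε1 hπ hf hC (t + 1)).trans ?_
  exact mul_le_mul_of_nonneg_left (pow_le_pow_of_le_one hr0 hr1.le
    (Nat.div_le_div_right (Nat.le_succ t))) (by positivity)

/-- **The truncation tail**: `Σ'_t |C_f̄(t + W + 1)| ≤ 2 (2C)² (m/ε) (1 − ε)^{⌊(W+1)/m⌋}`. -/
theorem tsum_abs_autocov_shift_le_of_nHit
    (hmin : ∀ x {B : Set S}, MeasurableSet B → ε * ν B ≤ nHit κ m x B) (hε0 : 0 < ε) (hε1 : ε ≤ 1)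
    (hm : 0 < m) (hπ : Kernel.Invariant κ π) {f : S → ℝ} (hf : Measurable f) {C : ℝ}
    (hC : ∀ x, |f x| ≤ C) (W : ℕ) :
    ∑' t, |Scoring.autocov κ π (fun y => f y - ∫ z, f z ∂π) (t + W + 1)|
      ≤ 2 * (2 * C) ^ 2 * (m / ε.toReal) * (1 - ε.toReal) ^ ((W + 1) / m) := by
  have hεtop : ε ≠ ∞ := ne_top_of_le_ne_top ENNReal.one_ne_top hε1
  have hεpos : 0 < ε.toReal := ENNReal.toReal_pos hε0.ne' hεtop
  have hr0 : 0 ≤ 1 - ε.toReal :=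
    sub_nonneg.2 (ENNReal.toReal_le_of_le_ofReal zero_le_one (by simpa using hε1))
  have hr1 : 1 - ε.toReal < 1 := sub_lt_self _ hεpos
  refine Real.tsum_le_of_sum_range_le (fun t => abs_nonneg _) fun n => ?_
  have hterm : ∀ t, |Scoring.autocov κ π (fun y => f y - ∫ z, f z ∂π) (t + W + 1)|
      ≤ 2 * (2 * C) ^ 2 * (1 - ε.toReal) ^ ((W + 1) / m) * (1 - ε.toReal) ^ (t / m) := by
    intro t
    refine (abs_autocov_centred_le_of_nHit hmin hε1 hπ hf hC (t + W + 1)).trans ?_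
    rw [mul_assoc (2 * (2 * C) ^ 2), ← pow_add]
    refine mul_le_mul_of_nonneg_left (pow_le_pow_of_le_one hr0 hr1.le ?_) (by positivity)
    have h := Nat.add_div_le_add_div (W + 1) t m
    have heq : W + 1 + t = t + W + 1 := by ring
    rw [heq] at h
    exact h
  calc ∑ t ∈ range n, |Scoring.autocov κ π (fun y => f y - ∫ z, f z ∂π) (t + W + 1)|
      ≤ ∑ t ∈ range n, 2 * (2 * C) ^ 2 * (1 - ε.toReal) ^ ((W + 1) / m) * (1 - ε.toReal) ^ (t / m) :=
        Finset.sum_le_sum fun t _ => hterm t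
    _ = 2 * (2 * C) ^ 2 * (1 - ε.toReal) ^ ((W + 1) / m) * ∑ t ∈ range n, (1 - ε.toReal) ^ (t / m) := by
        rw [Finset.mul_sum]
    _ ≤ 2 * (2 * C) ^ 2 * (1 - ε.toReal) ^ ((W + 1) / m) * (m / (1 - (1 - ε.toReal))) :=
        mul_le_mul_of_nonneg_left (Scoring.sum_range_pow_div_le hm hr0 hr1 n) (by positivity)
    _ = 2 * (2 * C) ^ 2 * (m / ε.toReal) * (1 - ε.toReal) ^ ((W + 1) / m) := by
        rw [sub_sub_cancel]; ring

end Tail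

/-! ## §2 The windowed statistic on a path -/

section Path

/-- On a constant stretch (`acovSum y N 0 = 0`) every lag estimate vanishes: `Γ̂_N(t) = 0`. -/
theorem gammaHat_eq_zero_of_acovSum_zero (y : ℕ → ℝ) {N : ℕ} (hS : Scoring.acovSum y N 0 = 0) (t : ℕ) :
    Scoring.gammaHat y N t = 0 := by
  have hdev : ∀ i ∈ range N, Scoring.dev y N i = 0 := by
    have h0 : ∑ i ∈ range N, Scoring.dev y N i ^ 2 = 0 := by
      rw [← Scoring.lagSum_zero]; exact hS
    intro i hi
    have := (Finset.sum_eq_zero_iff_of_nonneg fun j _ => sq_nonneg (Scoring.dev y N j)).1 h0 i hi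
    exact pow_eq_zero_iff (n := 2) (by norm_num) |>.1 this
  unfold Scoring.gammaHat Scoring.acovSum Scoring.lagSum
  rw [Finset.sum_eq_zero fun i hi => ?_, zero_div]
  have hi' : i < N - t := Finset.mem_range.1 hi
  rw [hdev i (Finset.mem_range.2 (by omega)), zero_mul]

/-- **The windowed sum IS scorer A's `Γ̂(0) · 2 τ̂_W`**, on every path:
`Γ̂_N(0) + 2 Σ_{t<W} Γ̂_N(t+1) = Γ̂_N(0) · (2 · tauIntWindow (rhoHat y N) W)`. -/
theorem gammaWindow_eq_gammaHat_mul_tauIntWindow (y : ℕ → ℝ) (N W : ℕ) :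
    Scoring.gammaHat y N 0 + 2 * ∑ t ∈ range W, Scoring.gammaHat y N (t + 1)
      = Scoring.gammaHat y N 0 * (2 * Scoring.tauIntWindow (Scoring.rhoHat y N) W) := by
  rcases Nat.eq_zero_or_pos N with hN | hN
  · subst hN
    have h0 : ∀ t, Scoring.gammaHat y 0 t = 0 := fun t => by
      unfold Scoring.gammaHat Scoring.acovSum Scoring.lagSum
      simp
    simp [h0]
  · by_cases hS : Scoring.acovSum y N 0 = 0
    · simp [gammaHat_eq_zero_of_acovSum_zero y hS]
    · exact (Scoring.gammaHat_mul_two_mul_tauIntWindow y hN.ne' hS W).symm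

/-- **Pointwise splitting of the windowed error**: with `a_t = Γ̂(t) − C(t)` and any tail value `T`
(`Σ' C(t+1) = Σ_{t<W} C(t+1) + T`):
`(Γ̂(0) + 2Σ_{t<W} Γ̂(t+1) − (C(0) + 2(Σ_{t<W} C(t+1) + T)))² ≤ 3 a_0² + 12 W Σ_{t<W} a_{t+1}² + 12 T²`. -/
theorem sq_gammaWindow_sub_le (G Cf : ℕ → ℝ) (T : ℝ) (W : ℕ) :
    (G 0 + 2 * ∑ t ∈ range W, G (t + 1) - (Cf 0 + 2 * (∑ t ∈ range W, Cf (t + 1) + T))) ^ 2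
      ≤ 3 * (G 0 - Cf 0) ^ 2 + 12 * (W * ∑ t ∈ range W, (G (t + 1) - Cf (t + 1)) ^ 2) + 12 * T ^ 2 := by
  set u := G 0 - Cf 0 with hu
  set v := ∑ t ∈ range W, (G (t + 1) - Cf (t + 1)) with hv
  have hv' : ∑ t ∈ range W, G (t + 1) - ∑ t ∈ range W, Cf (t + 1) = v := by
    rw [hv, Finset.sum_sub_distrib]
  have hexp : G 0 + 2 * ∑ t ∈ range W, G (t + 1) - (Cf 0 + 2 * (∑ t ∈ range W, Cf (t + 1) + T))
      = u + 2 * v - 2 * T := by rw [hu, ← hv']; ring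
  rw [hexp]
  have hcs : v ^ 2 ≤ W * ∑ t ∈ range W, (G (t + 1) - Cf (t + 1)) ^ 2 := by
    have h : (∑ t ∈ range W, (G (t + 1) - Cf (t + 1))) ^ 2
        ≤ #(range W) * ∑ t ∈ range W, (G (t + 1) - Cf (t + 1)) ^ 2 := _root_.sq_sum_le_card_mul_sum_sq
    rw [Finset.card_range] at h
    exact h
  nlinarith [sq_nonneg (u - 2 * v), sq_nonneg (u + 2 * T), sq_nonneg (2 * v + 2 * T),
    sq_nonneg (u - 2 * v + 2 * T)]

end Path

/-! ## §3 Integration of the splitting -/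

section Integral

omit [MeasurableSpace S] in
/-- Integration of the pointwise splitting `sq_gammaWindow_sub_le` for bounded measurable lag
statistics `G t` against a probability measure. -/
theorem integral_sq_windowSum_sub_le {Ω : Type*} [MeasurableSpace Ω] (P : Measure Ω)
    [IsProbabilityMeasure P] {G : ℕ → Ω → ℝ} (hGm : ∀ t, Measurable (G t)) {B : ℝ}
    (hGb : ∀ t x, |G t x| ≤ B) (Cf : ℕ → ℝ) (T : ℝ) (W : ℕ) :
    ∫ x, (G 0 x + 2 * ∑ t ∈ range W, G (t + 1) x - (Cf 0 + 2 * (∑ t ∈ range W, Cf (t + 1) + T))) ^ 2 ∂P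
      ≤ 3 * ∫ x, (G 0 x - Cf 0) ^ 2 ∂P
        + 12 * ((W : ℝ) * ∑ t ∈ range W, ∫ x, (G (t + 1) x - Cf (t + 1)) ^ 2 ∂P) + 12 * T ^ 2 := by
  have hia : ∀ t, Integrable (fun x => (G t x - Cf t) ^ 2) P := fun t =>
    Scoring.integrable_of_bounded P (((hGm t).sub measurable_const).pow_const 2)
      (C := (B + |Cf t|) ^ 2) fun x => by
        rw [abs_pow]
        exact pow_le_pow_left₀ (abs_nonneg _) ((abs_sub _ _).trans (add_le_add (hGb t x) le_rfl)) 2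
  have h0 : Integrable (fun x => 3 * (G 0 x - Cf 0) ^ 2) P := (hia 0).const_mul 3
  have h1 : Integrable (fun x => 12 * ((W : ℝ) * ∑ t ∈ range W, (G (t + 1) x - Cf (t + 1)) ^ 2)) P :=
    ((integrable_finsetSum _ fun t _ => hia (t + 1)).const_mul (W : ℝ)).const_mul 12
  have h01 : Integrable (fun x => 3 * (G 0 x - Cf 0) ^ 2
      + 12 * ((W : ℝ) * ∑ t ∈ range W, (G (t + 1) x - Cf (t + 1)) ^ 2)) P := h0.add h1
  have hall : Integrable (fun x => 3 * (G 0 x - Cf 0) ^ 2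
      + 12 * ((W : ℝ) * ∑ t ∈ range W, (G (t + 1) x - Cf (t + 1)) ^ 2) + 12 * T ^ 2) P :=
    h01.add (integrable_const _)
  calc ∫ x, (G 0 x + 2 * ∑ t ∈ range W, G (t + 1) x - (Cf 0 + 2 * (∑ t ∈ range W, Cf (t + 1) + T))) ^ 2 ∂P
      ≤ ∫ x, (3 * (G 0 x - Cf 0) ^ 2
        + 12 * ((W : ℝ) * ∑ t ∈ range W, (G (t + 1) x - Cf (t + 1)) ^ 2) + 12 * T ^ 2) ∂P :=
        integral_mono_of_nonneg (ae_of_all _ fun x => sq_nonneg _) hall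
          (ae_of_all _ fun x => sq_gammaWindow_sub_le (fun t => G t x) Cf T W)
    _ = 3 * ∫ x, (G 0 x - Cf 0) ^ 2 ∂P
        + 12 * ((W : ℝ) * ∑ t ∈ range W, ∫ x, (G (t + 1) x - Cf (t + 1)) ^ 2 ∂P) + 12 * T ^ 2 := by
        rw [integral_add h01 (integrable_const _), integral_add h0 h1, integral_const_mul,
          integral_const_mul, integral_const_mul, integral_finsetSum _ (fun t _ => hia (t + 1)),
          integral_const, probReal_univ, one_smul]

end Integral

end Summit.Ventures.LatticeQCDFlow.Exactness.GeneralNCMC
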